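import Literature.NumberTheory.GaloisRepresentations.MackeyInducedIrreducible
import Literature.NumberTheory.GaloisRepresentations.AbsGaloisOuterConj
import Mathlib.NumberTheory.Padics.Complex
import Mathlib.NumberTheory.NumberField.Basic
import HarnessLib

/-!
# Mackey: the induction of a Galois-REGULAR irreducible representation is irreducible
# (crux `AscentConjugationSolvable`, stmt-Langlands-1094; piece `CyclicPrimeAscent`; lead c3 helper stub H4)

Support file (closes nothing).  Let `L/K` be a Galois extension of number fields, `ℓ` a prime
and `ρ : Γ_L → GL_n(ℚ̄_ℓ)` an IRREDUCIBLE framed Galois representation which is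
**Galois-regular**: no conjugate `ρ^g = ρ ∘ θ_g` (`FramedGaloisRep.outerConj`) by an element
`g ∈ Γ_K` outside `res(Γ_L)` is isomorphic to `ρ` (no change of frame `P · ρ^g · P⁻¹ = ρ`).
Then the induced representation `Ind_{Γ_L}^{Γ_K} ρ` (`FramedGaloisRep.induce`, matrix model with
the chosen coset representatives `rᵢ = absGaloisCosetRep K L _ i`) is irreducible.

This is the "sufficient" half of Mackey's irreducibility criterion (Serre, *Linear
representations of finite groups*, §7.4, Prop. 23 and Cor.), which the tree proves in matrix
form as `FramedGaloisRep.isIrreducible_induce_of_forall_ne_conj` under the hypothesis that the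
conjugates `ρ^{rᵢ⁻¹}` are pairwise non-conjugate.  That hypothesis follows from regularity: if
`ρ^{rⱼ⁻¹} = P · ρ^{rᵢ⁻¹} · P⁻¹` with `i ≠ j`, conjugating by `rⱼ` (`outerConj_mul`:
`ρ^{τ τ'} = (ρ^τ)^{τ'}`; `conj P` commutes with `outerConj`) gives `ρ = P · ρ^{rᵢ⁻¹ rⱼ} · P⁻¹`,
while `rᵢ⁻¹ rⱼ ∉ res(Γ_L)` because `rᵢ`, `rⱼ` represent distinct cosets
(`absGaloisCosetRep_bijective`, `QuotientGroup.eq`).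

References: J.-P. Serre, *Linear representations of finite groups*, GTM 42 (1977), §7.4
Prop. 23 and Cor.; C. W. Curtis, I. Reiner, *Representation theory of finite groups and
associative algebras* (1962), (10.25).
-/

noncomputable section

set_option linter.dupNamespace false -- project-wide option; `Summit.Langlands.Langlands` is the mandated namespace

namespace Summit.Langlands.Langlands.Theorems.SmithKummerSeedCyclicPrimeAscent

open scoped MatrixGroups NumberField Classical Matrix Polynomial
open Filter IsDedekindDomain Field
open Literature.NumberTheory.GaloisRepresentations

/-- **Mackey: the induction of a Galois-REGULAR irreducible is irreducible.**  For `L/K` Galois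
(number fields), `ρ : Γ_L → GL_n(ℚ̄_ℓ)` irreducible and such that no conjugate `ρ^g`,
`g ∉ res(Γ_L)`, is isomorphic to `ρ`, the induced representation `Ind_{Γ_L}^{Γ_K} ρ`
(`FramedGaloisRep.induce`) is irreducible.  Reduced to the tree's matrix form of Mackey's
criterion `FramedGaloisRep.isIrreducible_induce_of_forall_ne_conj`: a conjugacy
`ρ^{rⱼ⁻¹} = P ρ^{rᵢ⁻¹} P⁻¹` between the conjugates by two coset representatives, `i ≠ j`, becomes
after conjugating by `rⱼ` (`outerConj_mul`) an isomorphism `P ρ^{rᵢ⁻¹ rⱼ} P⁻¹ = ρ` with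
`rᵢ⁻¹ rⱼ ∉ res(Γ_L)` (distinct cosets, `absGaloisCosetRep_bijective`), excluded by regularity.
[cite: SerreLinearRepresentations1977, §7.4 Prop. 23 and Cor.] -/
theorem isIrreducible_induce_of_regular : ∀ (K L : Type) [Field K] [NumberField K] [Field L] [NumberField L] [Algebra K L] [IsGalois K L] (ℓ : ℕ) [Fact ℓ.Prime] (n : ℕ) (ρ : Literature.NumberTheory.GaloisRepresentations.FramedGaloisRep L (PadicAlgCl ℓ) n), ρ.toGaloisRep.IsIrreducible → (∀ g : Field.absoluteGaloisGroup K, g ∉ Set.range (Literature.NumberTheory.GaloisRepresentations.absGaloisRestrict K L) → ∀ P : GL (Fin n) (PadicAlgCl ℓ), Literature.NumberTheory.GaloisRepresentations.FramedRep.conj P (ρ.outerConj g) ≠ ρ) → (ρ.induce K (rfl : Module.finrank K L = Module.finrank K L)).toGaloisRep.IsIrreducible := by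
  intro K L _ _ _ _ _ _ ℓ _ n ρ hirr hreg
  refine FramedGaloisRep.isIrreducible_induce_of_forall_ne_conj K rfl ρ hirr fun i j hij P hP => ?_
  -- `rᵢ⁻¹ rⱼ ∉ res(Γ_L)`: `rᵢ`, `rⱼ` represent distinct cosets of `Γ_K / res(Γ_L)`
  have hg : (absGaloisCosetRep K L rfl i)⁻¹ * absGaloisCosetRep K L rfl j ∉
      Set.range (absGaloisRestrict K L) := fun hmem =>
    hij ((absGaloisCosetRep_bijective K L rfl).1 (QuotientGroup.eq.2 hmem))
  refine hreg _ hg P ?_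
  -- conjugate `hP : ρ^{rⱼ⁻¹} = P ρ^{rᵢ⁻¹} P⁻¹` by `rⱼ`
  calc FramedRep.conj P (ρ.outerConj ((absGaloisCosetRep K L rfl i)⁻¹ * absGaloisCosetRep K L rfl j))
      = FramedGaloisRep.outerConj (absGaloisCosetRep K L rfl j)
          (FramedRep.conj P (ρ.outerConj (absGaloisCosetRep K L rfl i)⁻¹)) := by
        rw [FramedGaloisRep.outerConj_mul]
        exact ContinuousMonoidHom.ext fun σ => rfl
    _ = (ρ.outerConj (absGaloisCosetRep K L rfl j)⁻¹).outerConj (absGaloisCosetRep K L rfl j) := by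
        rw [hP]
    _ = ρ := by
        rw [← FramedGaloisRep.outerConj_mul, inv_mul_cancel, FramedGaloisRep.outerConj_one]

end Summit.Langlands.Langlands.Theorems.SmithKummerSeedCyclicPrimeAscent

end
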